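import Summits.Ventures.CertifiedManyBodySolver.Observables.StructureFactorsCommensurate

/-!
# Explicit stripe cosine tables (M3-L1 follow-up to `StructureFactorsCommensurate`, seat m3-7 gen 3)

HONEST FRAMING: objects and exact identities only; no bound on any Hubbard state is claimed in
this file (first certified bounds are the programme; this is not a superconductivity verdict).

`StructureFactorsCommensurate` shows that on every `L = m n` torus the structure factor at the
commensurate momentum `2πκ/m` is the `m`-periodic table `r ↦ cos (2π ((κ·(r mod m)).val)/m)` applied
to the correlation function.  Here the two STRIPE tables of record are put in closed form, so that a
reviewer can read the row functional off one lemma: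

* charge, `Q_c = (π/4, 0)` on `8n × 8n`:  weight `cos (π r₀ / 4)` (`r₀ = (r 0).val`, any representative:
  the weight is `8`-periodic);
* spin, `Q_s = (7π/8, π)` on `16n × 16n`: weight `cos (7π r₀ / 8 + π r₁)`.
-/

namespace Summit.Ventures.CertifiedManyBodySolver.Observables

open Literature.MathematicalPhysics.QuantumLattice Literature.Probability.LatticeModels
open scoped BigOperators

/-- Periodicity bookkeeping: `cos (2π (w mod m)/m) = cos (2π w/m)` for naturals. -/
theorem cos_two_pi_mul_mod_div (w m : ℕ) [NeZero m] :
    Real.cos (2 * Real.pi * ((w % m : ℕ) : ℝ) / m) = Real.cos (2 * Real.pi * (w : ℝ) / m) := by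
  have hm : (m : ℝ) ≠ 0 := by exact_mod_cast NeZero.ne m
  conv_rhs => rw [← Nat.div_add_mod w m]
  have h : 2 * Real.pi * ((m * (w / m) + w % m : ℕ) : ℝ) / m =
      2 * Real.pi * ((w % m : ℕ) : ℝ) / m + ((w / m : ℕ) : ℝ) * (2 * Real.pi) := by
    push_cast
    field_simp
    ring
  rw [h, Real.cos_add_nat_mul_two_pi]

variable (L : ℕ) [NeZero L]

/-- `reduceSite` IS the canonical projection `ℤ/L → ℤ/m` on each coordinate when `m ∣ L`
(justifying the name; the `val`-based definition merely avoids carrying the divisibility proof). -/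
theorem reduceSite_eq_castHom (m : ℕ) (h : m ∣ L) (x : TorusSite 2 L) (i : Fin 2) :
    reduceSite L m x i = ZMod.castHom h (ZMod m) (x i) := by
  show (((x i).val : ℕ) : ZMod m) = _
  rw [ZMod.castHom_apply, ZMod.cast_eq_val]

/-- The charge-stripe phase argument: `(1,0)·(r mod 8) = r₀.val (mod 8)`. -/
theorem torusDot_stripeCharge_reduce (r : TorusSite 2 L) :
    torusDot 8 (intMomentum 8 ![1, 0]) (reduceSite L 8 r) = (((r 0).val : ℕ) : ZMod 8) := by
  simp [torusDot, intMomentum, reduceSite, Fin.sum_univ_two]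

/-- The spin-stripe phase argument: `(7,8)·(r mod 16) = 7 r₀.val + 8 r₁.val (mod 16)`. -/
theorem torusDot_stripeSpin_reduce (r : TorusSite 2 L) :
    torusDot 16 (intMomentum 16 ![7, 8]) (reduceSite L 16 r) =
      ((7 * (r 0).val + 8 * (r 1).val : ℕ) : ZMod 16) := by
  simp [torusDot, intMomentum, reduceSite, Fin.sum_univ_two]

/-- **Charge-stripe weight in closed form:** `cos (2π ((1,0)·(r mod 8)).val / 8) = cos (π r₀ / 4)`. -/
theorem cos_stripeCharge_weight (r : TorusSite 2 L) :
    Real.cos (2 * Real.pi * ((torusDot 8 (intMomentum 8 ![1, 0]) (reduceSite L 8 r)).val : ℝ) / 8) =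
      Real.cos (Real.pi * ((r 0).val : ℝ) / 4) := by
  rw [torusDot_stripeCharge_reduce, ZMod.val_natCast]
  have h := cos_two_pi_mul_mod_div (r 0).val 8
  push_cast at h
  rw [h]
  congr 1
  ring

/-- **Spin-stripe weight in closed form:** `cos (2π ((7,8)·(r mod 16)).val / 16) = cos (7π r₀/8 + π r₁)`. -/
theorem cos_stripeSpin_weight (r : TorusSite 2 L) :
    Real.cos (2 * Real.pi * ((torusDot 16 (intMomentum 16 ![7, 8]) (reduceSite L 16 r)).val : ℝ) / 16) =
      Real.cos (7 * Real.pi * ((r 0).val : ℝ) / 8 + Real.pi * ((r 1).val : ℝ)) := by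
  rw [torusDot_stripeSpin_reduce, ZMod.val_natCast]
  have h := cos_two_pi_mul_mod_div (7 * (r 0).val + 8 * (r 1).val) 16
  push_cast at h
  rw [h]
  congr 1
  ring

/-- **Charge stripe row in closed form, every `8n × 8n` torus, every state:**
`S_c(Q_c; ψ) = ∑_r cos (π r₀/4) · C_c(r;ψ)`. -/
theorem densityStructureFactor_stripeCharge_table (n : ℕ) (hL : L = 8 * n)
    (ψ : Fock (Orb (FermionTorus 2 L))) :
    densityStructureFactor L (stripeChargeIndex L n) ψ =
      ∑ r : TorusSite 2 L, Real.cos (Real.pi * ((r 0).val : ℝ) / 4) * densityCorr L r ψ := by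
  rw [densityStructureFactor_stripeCharge L n hL]
  refine Finset.sum_congr rfl fun r _ => ?_
  rw [cos_stripeCharge_weight]

/-- **Spin stripe row in closed form, every `16n × 16n` torus, every state:**
`S_s(Q_s; ψ) = ∑_r cos (7π r₀/8 + π r₁) · C_s(r;ψ)`. -/
theorem spinStructureFactor_stripeSpin_table (n : ℕ) (hL : L = 16 * n)
    (ψ : Fock (Orb (FermionTorus 2 L))) :
    spinStructureFactor L (stripeSpinIndex L n) ψ =
      ∑ r : TorusSite 2 L, Real.cos (7 * Real.pi * ((r 0).val : ℝ) / 8 + Real.pi * ((r 1).val : ℝ))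
        * spinCorr L r ψ := by
  rw [spinStructureFactor_stripeSpin L n hL]
  refine Finset.sum_congr rfl fun r _ => ?_
  rw [cos_stripeSpin_weight]

end Summit.Ventures.CertifiedManyBodySolver.Observables
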